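import Mathlib
import Summits.Schanuel.Schanuel.Theorems.RigidCoreMinimalCounterexampleInAclLogSector
import Summits.Schanuel.Schanuel.Theorems.RigidCoreMinimalCounterexampleInAclMateGrowthBounds
import Summits.Schanuel.Schanuel.Theorems.RigidCoreMinimalCounterexampleInAclAclCriterion
import Literature.NumberTheory.Transcendental.KernelTranslatesRankTwoSectors

/-!
# Mates of a rank-2 first failure, III: two-sided polynomial size of `K`-elements along the ℚ-locus — crux stmt-Schanuel-0969

Route `RigidCore`, crux (S*) `MinimalCounterexampleInAcl` (item stmt-Schanuel-0969), line `kernel-arithmetic-selection`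
(lead prover-line-stmt-Schanuel-0969-c6-0, gen 19), landed `--supports stmt-Schanuel-0969`: the registered stub
`stub_mateCoeffGrowth` (Stub G of the skeleton, "algebra + Cauchy").

For `x ∈ ℂ²` with `trdeg ℚ(x, eˣ) < 2` and `F ∈ ℚ[w₀, w₁, z₀, z₁]`, the element `f = F(x, eˣ)` of `K = ℚ(x, eˣ)` and
`x₀ ∈ K` are algebraically dependent: `m(f, x₀) = 0` with `m ≠ 0`.  Write `m = Σ_j a_j(B) A^j = M ∈ (ℚ[B])[A]`.
Substituting `B ↦ w₀`, `A ↦ F` turns `M` into a ℚ-polynomial relation `Σ_j a_j(w₀) F^j` of `(x, eˣ)`, which every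
point `y` of the ℚ-locus `locusPts x` therefore satisfies: `Σ_j a_j(y₀) F(y, e^y)^j = 0` (`eval_spec_eq_zero_of_mem_locusPts`).
Beyond the zeros of the top coefficient, Cauchy's root bound gives `‖F(y, e^y)‖ ≤ C (1 + ‖y₀‖)^D`
(`norm_le_of_eval_spec_eq_zero`); when `f ≠ 0` we first divide `M` by the power of `A` it contains (so `a₀ ≠ 0`,
the relation still holds at `f`), and REVERSING the relation bounds `‖F(y, e^y)⁻¹‖` the same way beyond the zeros
of `a₀` (`norm_inv_le_of_eval_spec_eq_zero`).  The toolkit (`cauchy_bound`, `norm_eval_le`, `exists_norm_eval_ge`,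
`aeval_eq_eval_coefC`) is Theorems/…MateGrowthBounds.lean; the dependence `m` is Literature
`exists_mvPolynomial_of_trdeg_lt_two` / `eval_map_finSuccEquiv`.
-/

noncomputable section

set_option linter.dupNamespace false

open Complex Polynomial Finset
open Literature.NumberTheory.Transcendental.KernelTranslatesRankTwo (eval_map_finSuccEquiv
  exists_mvPolynomial_of_trdeg_lt_two)

namespace Summit.Schanuel.Schanuel.Cruxes.MinimalCounterexampleInAcl.KernelArithmeticSelection

open MateGrowth

/-- A coefficient `c ∈ ℚ[B]` (as `MvPolynomial (Fin 1) ℚ`) viewed as a complex polynomial (local notation, no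
definition; the `coefC[c]` of Theorems/…MateGrowthBounds.lean). -/
local notation3 "coefC[" c "]" =>
  (Polynomial.map (algebraMap ℚ ℂ) (MvPolynomial.uniqueAlgEquiv ℚ (Fin 1) c) : Polynomial ℂ)

/-- The specialisation `B ↦ s` of `P = Σ_j a_j(B) A^j ∈ (ℚ[B])[A]`: the complex polynomial `Σ_j a_j(s) A^j`
(local notation, no definition). -/
local notation3 (prettyPrint := false) "spec[" P ", " s "]" =>
  (Polynomial.map (MvPolynomial.aeval (fun _ : Fin 1 => s) : MvPolynomial (Fin 1) ℚ →ₐ[ℚ] ℂ).toRingHom P :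
    Polynomial ℂ)

/-! ## Relations `P(F) = 0`, `P ∈ (ℚ[B])[A]`, specialised along `B ↦ s`: Cauchy bounds -/

/-- Normal form of the specialised relation: `P^{(s)}(w) = Σ_{j ≤ deg P} a_j(s) w^j` with `a_j = coefC[P.coeff j]`. -/
theorem eval_spec_eq_sum (P : Polynomial (MvPolynomial (Fin 1) ℚ)) (s w : ℂ) :
    (spec[P, s]).eval w = ∑ j ∈ range (P.natDegree + 1), (coefC[P.coeff j]).eval s * w ^ j := by
  rw [Polynomial.eval_eq_sum_range' (n := P.natDegree + 1)
    (Nat.lt_succ_of_le Polynomial.natDegree_map_le)]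
  refine Finset.sum_congr rfl fun j _ => ?_
  rw [Polynomial.coeff_map]
  congr 1
  exact aeval_eq_eval_coefC (P.coeff j) s

/-- **Cauchy bound along a specialised relation** (leading-coefficient dominance): for `P ≠ 0` there are
`R₀, C, D` with `‖w‖ ≤ max 1 (C (1 + ‖s‖)^D)` whenever `P^{(s)}(w) = 0` and `‖s‖ ≥ R₀` (beyond the zeros of the
top coefficient `a_{deg P}`). -/
theorem norm_le_of_eval_spec_eq_zero {P : Polynomial (MvPolynomial (Fin 1) ℚ)} (hP : P ≠ 0) :
    ∃ R₀ C : ℝ, ∃ D : ℕ, 0 ≤ C ∧ ∀ s w : ℂ, (spec[P, s]).eval w = 0 → R₀ ≤ ‖s‖ →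
      ‖w‖ ≤ max 1 (C * (1 + ‖s‖) ^ D) := by
  -- adapted from `MateGrowth.norm_exp_le_of_expPoly_eq_zero` (`e^s` replaced by `w`)
  classical
  set d := P.natDegree with hd
  set g : ℕ → ℂ[X] := fun j => coefC[P.coeff j] with hg
  have hgd : g d ≠ 0 := coefC_ne_zero (by rw [hd]; exact Polynomial.leadingCoeff_ne_zero.2 hP)
  obtain ⟨R₀, κ, hκ, hlow⟩ := exists_norm_eval_ge (g d) hgd
  set Cj : ℕ → ℝ := fun j => ∑ i ∈ range ((g j).natDegree + 1), ‖(g j).coeff i‖ with hCj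
  have hCj0 : ∀ j, 0 ≤ Cj j := fun j => Finset.sum_nonneg fun i _ => norm_nonneg _
  set D : ℕ := (range d).sup fun j => (g j).natDegree with hD
  set K : ℝ := ∑ j ∈ range d, Cj j with hK
  have hK0 : 0 ≤ K := Finset.sum_nonneg fun j _ => hCj0 j
  refine ⟨R₀, K / κ, D, div_nonneg hK0 hκ.le, fun s w hs hR => ?_⟩
  have hP1 : 1 ≤ 1 + ‖s‖ := by linarith [norm_nonneg s]
  have hz : ∑ j ∈ range (d + 1), (g j).eval s * w ^ j = 0 := by
    rw [← hs, eval_spec_eq_sum]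
  have hcb := cauchy_bound (fun j => (g j).eval s) w (d := d)
    (fun h0 => (lt_of_lt_of_le hκ (hlow s hR)).ne' (by rw [h0, norm_zero])) hz
  refine hcb.trans (max_le_max le_rfl ?_)
  have hnum : ∑ j ∈ range d, ‖(g j).eval s‖ ≤ K * (1 + ‖s‖) ^ D := by
    rw [hK, Finset.sum_mul]
    refine Finset.sum_le_sum fun j hj => ?_
    refine (norm_eval_le (g j) s).trans ?_
    refine mul_le_mul_of_nonneg_left ?_ (hCj0 j)
    exact pow_le_pow_right₀ hP1 (Finset.le_sup (f := fun j => (g j).natDegree) hj)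
  have hden : κ ≤ ‖(g d).eval s‖ := hlow s hR
  calc (∑ j ∈ range d, ‖(g j).eval s‖) / ‖(g d).eval s‖
      ≤ (K * (1 + ‖s‖) ^ D) / κ :=
        div_le_div₀ (mul_nonneg hK0 (pow_nonneg (by linarith) _)) hnum hκ hden
    _ = K / κ * (1 + ‖s‖) ^ D := by ring

/-- **Inverse Cauchy bound** (constant-coefficient dominance): if `P.coeff 0 ≠ 0` then, beyond the zeros of `a₀`,
a root `w` of `P^{(s)}` is non-zero with `‖w⁻¹‖ ≤ max 1 (C (1 + ‖s‖)^D)` (reverse the relation). -/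
theorem norm_inv_le_of_eval_spec_eq_zero {P : Polynomial (MvPolynomial (Fin 1) ℚ)} (hP : P.coeff 0 ≠ 0) :
    ∃ R₀ C : ℝ, ∃ D : ℕ, 0 ≤ C ∧ ∀ s w : ℂ, (spec[P, s]).eval w = 0 → R₀ ≤ ‖s‖ →
      w ≠ 0 ∧ ‖w⁻¹‖ ≤ max 1 (C * (1 + ‖s‖) ^ D) := by
  have hP0 : P ≠ 0 := fun h => hP (by rw [h, Polynomial.coeff_zero])
  obtain ⟨R₁, κ, hκ, hlow⟩ := exists_norm_eval_ge (coefC[P.coeff 0]) (coefC_ne_zero hP)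
  obtain ⟨R₂, C, D, hC, hbd⟩ :=
    norm_le_of_eval_spec_eq_zero (P := P.reverse) (fun h => hP0 (Polynomial.reverse_eq_zero.1 h))
  refine ⟨max R₁ R₂, C, D, hC, fun s w hs hR => ?_⟩
  have hw : w ≠ 0 := by
    rintro rfl
    have h0 : (spec[P, s]).eval 0 = (coefC[P.coeff 0]).eval s := by
      rw [← Polynomial.coeff_zero_eq_eval_zero, Polynomial.coeff_map]
      exact aeval_eq_eval_coefC (P.coeff 0) s
    have h1 := hlow s (le_trans (le_max_left _ _) hR)
    rw [← h0, hs, norm_zero] at h1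
    exact absurd h1 (not_le.2 hκ)
  refine ⟨hw, hbd s w⁻¹ ?_ (le_trans (le_max_right _ _) hR)⟩
  letI : Invertible w := invertibleOfNonzero hw
  rwa [Polynomial.eval_map, ← invOf_eq_inv w, Polynomial.eval₂_reverse_eq_zero_iff, ← Polynomial.eval_map]

/-! ## Transfer of the relation along the ℚ-locus -/

/-- The relation `Σ_j a_j(w₀) F^j` (`P = Σ_j a_j(B) A^j`, `B ↦ w₀`, `A ↦ F`) is a ℚ-polynomial in `(w, z)`; its
value at `(v, e^v)` is `P^{(v₀)}(F(v, e^v))`. -/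
theorem aeval_sum_rename_coeff_mul_pow (P : Polynomial (MvPolynomial (Fin 1) ℚ))
    (F : MvPolynomial (Fin 2 ⊕ Fin 2) ℚ) (v : Fin 2 → ℂ) :
    MvPolynomial.aeval (Sum.elim v (cexp ∘ v)) (∑ j ∈ range (P.natDegree + 1),
      MvPolynomial.rename (fun _ : Fin 1 => (Sum.inl 0 : Fin 2 ⊕ Fin 2)) (P.coeff j) * F ^ j) =
    (spec[P, v 0]).eval (MvPolynomial.aeval (Sum.elim v (cexp ∘ v)) F) := by
  rw [Polynomial.eval_eq_sum_range' (n := P.natDegree + 1)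
    (Nat.lt_succ_of_le Polynomial.natDegree_map_le), map_sum]
  refine Finset.sum_congr rfl fun j _ => ?_
  rw [map_mul, map_pow, MvPolynomial.aeval_rename, Polynomial.coeff_map]
  rfl

/-- **Transfer**: a relation `P^{(x₀)}(F(x, eˣ)) = 0` persists along the ℚ-locus of `(x, eˣ)`:
`P^{(y₀)}(F(y, e^y)) = 0` for every `y ∈ locusPts x`. -/
theorem eval_spec_eq_zero_of_mem_locusPts {x y : Fin 2 → ℂ} (hy : y ∈ locusPts x)
    {P : Polynomial (MvPolynomial (Fin 1) ℚ)} {F : MvPolynomial (Fin 2 ⊕ Fin 2) ℚ}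
    (hP : (spec[P, x 0]).eval (MvPolynomial.aeval (Sum.elim x (cexp ∘ x)) F) = 0) :
    (spec[P, y 0]).eval (MvPolynomial.aeval (Sum.elim y (cexp ∘ y)) F) = 0 := by
  rw [← aeval_sum_rename_coeff_mul_pow] at hP ⊢
  exact hy _ hP

/-- `F(x, eˣ) ∈ K = ℚ(x, eˣ)` for every `F ∈ ℚ[w, z]`. -/
theorem aeval_mem_adjoin (x : Fin 2 → ℂ) (F : MvPolynomial (Fin 2 ⊕ Fin 2) ℚ) :
    MvPolynomial.aeval (Sum.elim x (cexp ∘ x)) F ∈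
      IntermediateField.adjoin ℚ (Set.range x ∪ Set.range (cexp ∘ x)) := by
  have h : MvPolynomial.aeval (Sum.elim x (cexp ∘ x)) F ∈
      Algebra.adjoin ℚ (Set.range (Sum.elim x (cexp ∘ x))) := by
    rw [Algebra.adjoin_range_eq_range_aeval]
    exact (AlgHom.mem_range _).2 ⟨F, rfl⟩
  rw [Set.Sum.elim_range] at h
  exact IntermediateField.algebra_adjoin_le_adjoin ℚ _ h

/-! ## Registered stub (crux stmt-Schanuel-0969, line `kernel-arithmetic-selection`, gen 19, Stub G) -/

/-- **Stub G — TWO-SIDED POLYNOMIAL SIZE OF `K`-ELEMENTS ALONG THE LOCUS (algebra + Cauchy).**  For `x ∈ ℂ²` with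
`trdeg ℚ(x, eˣ) < 2`, every `F ∈ ℚ[w, z]` satisfies `‖F(y, e^y)‖ ≤ C(1+‖y₀‖)^D` for all `y` on the ℚ-locus of
`(x, eˣ)` with `‖y₀‖ ≥ R`, and `‖F(y, e^y)‖ ≥ C⁻¹(1+‖y₀‖)^{−D}` there as soon as `F(x, eˣ) ≠ 0`: `F(x, eˣ)` and `x₀`
are algebraically dependent (`trdeg < 2`), the relation `Σ_j a_j(w₀) F^j ∈ P_x` (normalised to `a₀ ≠ 0` when
`F(x, eˣ) ≠ 0`) transfers to the locus, and Cauchy's root bound applies to `F(y, e^y)` and to its inverse off the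
zeros of the top and bottom coefficients.  (The transcendence of `x₀` is not needed.) -/
theorem stub_mateCoeffGrowth : ∀ (x : Fin 2 → ℂ), Algebra.trdeg ℚ ↥(IntermediateField.adjoin ℚ (Set.range x ∪ Set.range (Complex.exp ∘ x))) < (2 : Cardinal) → Transcendental ℚ (x 0) → ∀ F : MvPolynomial (Fin 2 ⊕ Fin 2) ℚ, ∃ R C : ℝ, ∃ D : ℕ, 0 < C ∧ ∀ y : Fin 2 → ℂ, y ∈ Summit.Schanuel.Schanuel.Cruxes.MinimalCounterexampleInAcl.KernelArithmeticSelection.locusPts x → R ≤ ‖y 0‖ → ‖MvPolynomial.aeval (Sum.elim y (Complex.exp ∘ y)) F‖ ≤ C * (1 + ‖y 0‖) ^ D ∧ (MvPolynomial.aeval (Sum.elim x (Complex.exp ∘ x)) F ≠ 0 → C⁻¹ * ((1 + ‖y 0‖) ^ D)⁻¹ ≤ ‖MvPolynomial.aeval (Sum.elim y (Complex.exp ∘ y)) F‖) := by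
  intro x htr _ F
  classical
  set f : ℂ := MvPolynomial.aeval (Sum.elim x (Complex.exp ∘ x)) F with hf
  by_cases hf0 : f = 0
  · -- `F` is itself a relation of `(x, eˣ)`, so it vanishes on the whole locus
    refine ⟨0, 1, 0, one_pos, fun y hy _ => ⟨?_, fun h => absurd hf0 h⟩⟩
    rw [hy F hf0, norm_zero, pow_zero, mul_one]
    exact zero_le_one
  -- (a) `f` and `x₀` are algebraically dependent over `ℚ`: `M^{(x₀)}(f) = 0`, `M = finSuccEquiv m ≠ 0`
  obtain ⟨m, hm0, hm⟩ :=
    exists_mvPolynomial_of_trdeg_lt_two htr (aeval_mem_adjoin x F) (mem_adjoin_self x 0)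
  have hrel : (spec[MvPolynomial.finSuccEquiv ℚ 1 m, x 0]).eval f = 0 :=
    (eval_map_finSuccEquiv m f (x 0)).trans hm
  set M := MvPolynomial.finSuccEquiv ℚ 1 m with hM
  have hMne : M ≠ 0 := by rw [hM]; exact (EmbeddingLike.map_ne_zero_iff).2 hm0
  -- (b) normalise: `M = A^t · M₁` with `M₁.coeff 0 ≠ 0`, and still `M₁^{(x₀)}(f) = 0` since `f ≠ 0`
  obtain ⟨M₁, hM₁⟩ : (X : Polynomial (MvPolynomial (Fin 1) ℚ)) ^ M.natTrailingDegree ∣ M :=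
    Polynomial.X_pow_dvd_iff.2 fun j hj => Polynomial.coeff_eq_zero_of_lt_natTrailingDegree hj
  have hM₁0 : M₁.coeff 0 ≠ 0 := by
    have h := Polynomial.coeff_X_pow_mul M₁ M.natTrailingDegree 0
    rw [zero_add, ← hM₁] at h
    rw [← h]
    exact mt Polynomial.trailingCoeff_eq_zero.1 hMne
  have hM₁ne : M₁ ≠ 0 := fun h => hM₁0 (by rw [h, Polynomial.coeff_zero])
  have hrel₁ : (spec[M₁, x 0]).eval f = 0 := by
    have h1 : (spec[(X : Polynomial (MvPolynomial (Fin 1) ℚ)) ^ M.natTrailingDegree * M₁, x 0]).eval f =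
        f ^ M.natTrailingDegree * (spec[M₁, x 0]).eval f := by
      rw [Polynomial.map_mul, Polynomial.map_pow, Polynomial.map_X, Polynomial.eval_mul,
        Polynomial.eval_pow, Polynomial.eval_X]
    rw [← hM₁, hrel] at h1
    exact ((mul_eq_zero.1 h1.symm).resolve_left (pow_ne_zero _ hf0))
  -- (c), (d) Cauchy bounds along the transferred relation, direct and reversed
  obtain ⟨R₁, C₁, D₁, hC₁, hup⟩ := norm_le_of_eval_spec_eq_zero hM₁ne
  obtain ⟨R₂, C₂, D₂, hC₂, hlow⟩ := norm_inv_le_of_eval_spec_eq_zero hM₁0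
  have hC0 : 0 ≤ max C₁ C₂ := le_max_of_le_left hC₁
  refine ⟨max R₁ R₂, 1 + max C₁ C₂, max D₁ D₂, by linarith, fun y hy hR => ?_⟩
  have hy₁ : (spec[M₁, y 0]).eval (MvPolynomial.aeval (Sum.elim y (cexp ∘ y)) F) = 0 :=
    eval_spec_eq_zero_of_mem_locusPts hy hrel₁
  have hP1 : 1 ≤ 1 + ‖y 0‖ := by linarith [norm_nonneg (y 0)]
  have hbig : ∀ (C : ℝ) (D : ℕ), C ≤ max C₁ C₂ → D ≤ max D₁ D₂ →
      max 1 (C * (1 + ‖y 0‖) ^ D) ≤ (1 + max C₁ C₂) * (1 + ‖y 0‖) ^ max D₁ D₂ := by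
    intro C D hCle hDle
    refine max_le ?_ ?_
    · exact one_le_mul_of_one_le_of_one_le (by linarith) (one_le_pow₀ hP1)
    · exact mul_le_mul (by linarith) (pow_le_pow_right₀ hP1 hDle) (pow_nonneg (by linarith) _)
        (by linarith)
  refine ⟨(hup (y 0) _ hy₁ (le_trans (le_max_left _ _) hR)).trans
    (hbig C₁ D₁ (le_max_left _ _) (le_max_left _ _)), fun _ => ?_⟩
  obtain ⟨hw, hinv⟩ := hlow (y 0) _ hy₁ (le_trans (le_max_right _ _) hR)
  have h2 := hinv.trans (hbig C₂ D₂ (le_max_right _ _) (le_max_right _ _))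
  rw [norm_inv] at h2
  rw [← mul_inv]
  exact inv_le_of_inv_le₀ (norm_pos_iff.2 hw) h2

end Summit.Schanuel.Schanuel.Cruxes.MinimalCounterexampleInAcl.KernelArithmeticSelection

end
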